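import Literature.AlgebraicGeometry.Resolution.NormalizationInNormal
import Literature.AlgebraicGeometry.Resolution.NormalizationInExtension
import Literature.RingTheory.IntegralClosure.KrullIntersection
import Mathlib.AlgebraicGeometry.Noetherian
import HarnessLib

set_option linter.dupNamespace false -- mandated namespace of this single-conjunct summit

/-!
# The normalization of a variety in a finite extension is regular in codimension `≤ 1`

Crux `Picover` (stmt-ResolutionOfSingularities-0554), line `giraud-separated-base`, stub
`isRegularLocalRing_stalk_normalizationIn_of_ringKrullDim_le_one`.

**Setting.** `W` an integral scheme locally of finite type over a field `k`, `L` a finite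
extension of its function field `K(W)`, `W^L = normalizationIn W L` the normalization of `W`
in `L`.  **Claim.** Every local ring of `W^L` of dimension `≤ 1` is a regular local ring, i.e.
the singularities of `W^L` live in codimension `≥ 2`.

**Proof.** The local ring `𝒪_{W^L, x}` is a local domain (`W^L` is integral), Noetherian
(`W^L → W → Spec k` is locally of finite type since `W^L → W` is finite, E. Noether /
Liu 2002, Prop. 4.1.27, `isFinite_normalizationInι`, so `W^L` is locally Noetherian, Mathlib
`LocallyOfFiniteType.isLocallyNoetherian`), and integrally closed (`W^L` is normal,
`isIntegrallyClosed_stalk_normalizationIn`, Liu 2002, Def. 4.1.24).  A normal Noetherian local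
domain of dimension `≤ 1` is a field or a discrete valuation ring (Matsumura, Thm. 11.2), hence
regular (`isRegularLocalRing_of_isIntegrallyClosed_of_ringKrullDim_le_one`).
-/

noncomputable section

open CategoryTheory AlgebraicGeometry Literature.AlgebraicGeometry.Resolution

namespace Summit.ResolutionOfSingularities.ResolutionOfSingularities.Theorems.Picover.NormalizationInCodimOne

/-- The normalization `W^L` of an integral scheme `W` locally of finite type over a field `k`
in a finite extension `L ⊇ K(W)` is locally Noetherian: `W^L → W` is finite
(`isFinite_normalizationInι`), so `W^L → Spec k` is locally of finite type. [folklore] -/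
theorem isLocallyNoetherian_normalizationIn (k : Type) [Field k] (W : Scheme.{0}) [IsIntegral W]
    (f : W ⟶ Spec (.of k)) [LocallyOfFiniteType f] (L : Type) [Field L]
    [Algebra W.functionField L] [FiniteDimensional W.functionField L] :
    IsLocallyNoetherian (normalizationIn W L) := by
  haveI : IsFinite (normalizationInι W L) := isFinite_normalizationInι W L f
  exact LocallyOfFiniteType.isLocallyNoetherian (normalizationInι W L ≫ f)

/-- **The normalization in a finite extension is regular in codimension `≤ 1`.** For an
integral scheme `W` locally of finite type over a field `k` and a finite extension `L` of
`K(W)`, every local ring of `W^L = normalizationIn W L` of Krull dimension `≤ 1` is a regular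
local ring: it is a normal (`isIntegrallyClosed_stalk_normalizationIn`) Noetherian local
domain of dimension `≤ 1`, hence a field or a discrete valuation ring
(`isRegularLocalRing_of_isIntegrallyClosed_of_ringKrullDim_le_one`, Matsumura Thm. 11.2). -/
theorem isRegularLocalRing_stalk_normalizationIn_of_ringKrullDim_le_one : ∀ (k : Type) [Field k] (W : Scheme.{0}) [IsIntegral W] (f : W ⟶ Spec (.of k)) [LocallyOfFiniteType f] (L : Type) [Field L] [Algebra W.functionField L] [FiniteDimensional W.functionField L] (x : ↥(normalizationIn W L)), ringKrullDim ((normalizationIn W L).presheaf.stalk x) ≤ 1 → IsRegularLocalRing ((normalizationIn W L).presheaf.stalk x) := by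
  intro k _ W _ f _ L _ _ _ x hx
  haveI : IsLocallyNoetherian (normalizationIn W L) := isLocallyNoetherian_normalizationIn k W f L
  haveI : IsNoetherianRing ((normalizationIn W L).presheaf.stalk x) := inferInstance
  haveI : IsIntegrallyClosed ((normalizationIn W L).presheaf.stalk x) :=
    isIntegrallyClosed_stalk_normalizationIn W L x
  exact Literature.RingTheory.IntegralClosure.isRegularLocalRing_of_isIntegrallyClosed_of_ringKrullDim_le_one
    ((normalizationIn W L).presheaf.stalk x) hx

end Summit.ResolutionOfSingularities.ResolutionOfSingularities.Theorems.Picover.NormalizationInCodimOne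

end
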